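import Literature.Analysis.FluidPDE.TorusNSGevreyCoefficients
import HarnessLib

/-!
# Spectral moments of smooth slices and truncated Gevrey sums on a time window

Analysis/FluidPDE support file (theorems only), third of the files proving the Gevrey-class
smoothing estimate of Foias–Temam (J. Funct. Anal. 87 (1989), Thm 1.1) for classical solutions
of the Navier–Stokes system on `T^d`. It controls the size of the (truncated, weighted) spectral
sums of a smooth slice `v` and of the slices of a jointly smooth field on a compact time window:

* `hasSum_freqNormSq_mul_norm_sq_mFourierCoeff`, `hasSum_freqNormSq_sq_mul_norm_sq_mFourierCoeff` —
  **Parseval for the first two spectral moments**: `∑ₖ 4π²|k|² ‖v̂(k)‖² = ‖∇v‖₂²` and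
  `∑ₖ (4π²|k|²)² ‖v̂(k)‖² = ∫ ‖Δv‖²` (Grafakos 2014, Prop. 3.2.6 (8), Prop. 3.2.7 (3));
* `summable_weight_mul_freqNormSq_mul`, `summable_weight_mul_freqNormSq_sq_mul` — with a bounded
  weight `0 ≤ w ≤ W` the weighted moments are summable and bounded by `W (4π²)⁻¹ ‖∇v‖₂²`,
  `W (4π²)⁻² ∫ ‖Δv‖²` (this is how the TRUNCATED Gevrey weights `exp (2ψ min(|k|, N)) ≤ e^{2ψN}`
  of `TorusNSGevreyLattice` give finite Gevrey sums for smooth slices);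
* `tsum_freqNormSq_mul_le_tsum_freqNormSq_sq_mul` — `∑ w|k|²‖v̂‖² ≤ ∑ w|k|⁴‖v̂‖²` (`|k|² ≤ |k|⁴` on `ℤ^d`);
* `tendsto_sum_freqBall` — partial sums over the frequency balls converge to the series;
* `IsSmoothSpaceTimeOn.exists_forall_integral_norm_laplacian_sq_le` — on a compact window
  `[a, b]` the `H²` seminorm `∫ ‖Δu(t)‖²` of a jointly smooth field is bounded uniformly in `t`;
* `continuousOn_sum_exp_sq_mul`, `hasDerivWithinAt_sum_exp_sq_mul_freqNormSq_mul` — continuity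
  and the time derivative (product rule termwise) of the FINITE truncated Gevrey sums
  `∑_{k ∈ ball R} exp((s−t₀)min(|k|,N))² |k|² ‖û(s,k)‖²` of a jointly smooth field on `[t₀, t₁]`.

## Mathlib / tree search

Tree (reused): `Torus.hasSum_sq_norm_mFourierCoeff_complexify` (`TorusVectorParseval`),
`Torus.mFourierCoeff_complexify_partialDeriv` (`TorusTrigPoly`),
`Torus.mFourierCoeff_complexify_laplacian` (`TorusFourierModes`), `Torus.tendsto_freqBall_atTop`,
`Torus.IsSmoothSpaceTimeOn.laplacian / exists_norm_le_of_isCompact` (`TorusSpaceTime`); the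
`ℝ≥0∞` first-moment identity `Torus.tsum_freqNormSq_mul_enorm_sq_mFourierCoeff_complexify`
(`TorusFourierCalculus`) is the extended-real twin of the first lemma.

References: L. Grafakos, *Classical Fourier Analysis*, 3rd ed. (2014), Prop. 3.2.6 (8),
Prop. 3.2.7 (3) [Grafakos2014]; C. Foias, R. Temam, J. Funct. Anal. 87 (1989), §2 [FoiasTemam1989].
-/

noncomputable section

open MeasureTheory Set Filter UnitAddTorus Function Finset
open scoped Topology BigOperators InnerProductSpace

namespace Literature.Analysis.FluidPDE

namespace NSGevrey

open Literature.Analysis.FunctionSpaces Literature.Analysis.FunctionSpaces.Torus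

variable {d : Type*} [Fintype d] [DecidableEq d]

/-! ### Parseval for the first two spectral moments of a smooth slice -/

section Parseval

omit [DecidableEq d] in
/-- On the lattice `|k|² ≤ |k|⁴` (`|k|² ∈ {0} ∪ [1, ∞)`), so first moments are dominated by second
moments termwise. [folklore] -/
theorem freqNormSq_le_freqNormSq_sq (k : d → ℤ) : freqNormSq k ≤ freqNormSq k ^ 2 := by
  by_cases hk : k = 0
  · rw [hk, freqNormSq_zero]; norm_num
  · have h1 := one_le_freqNormSq_of_ne_zero hk
    nlinarith

variable {v : UnitAddTorus d → EuclideanSpace ℝ d}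

/-- **Spectral enstrophy**: for smooth real `v`,
`∑ₖ 4π²|k|² ‖𝓕(complexify ∘ v)(k)‖² = ∫ ∑ᵢ ‖∂ᵢ v‖² = ‖∇v‖₂²` as a `HasSum`
(Parseval for each `∂ᵢ v` and `𝓕(∂ᵢ v)(k) = 2πi kᵢ v̂(k)`; Grafakos 2014, Prop. 3.2.6 (8),
Prop. 3.2.7 (3)). [cite: Grafakos2014, Prop. 3.2.7 (3)] -/
theorem hasSum_freqNormSq_mul_norm_sq_mFourierCoeff (hv : IsSmooth v) :
    HasSum (fun k : d → ℤ => 4 * Real.pi ^ 2 * freqNormSq k *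
      ‖mFourierCoeff (EuclideanSpace.complexify ∘ v) k‖ ^ 2) (gradNormSq v) := by
  have hi : ∀ i : d, HasSum (fun k : d → ℤ => ‖mFourierCoeff (EuclideanSpace.complexify ∘ partialDeriv i v) k‖ ^ 2)
      (∫ x, ‖partialDeriv i v x‖ ^ 2) := fun i =>
    hasSum_sq_norm_mFourierCoeff_complexify ((hv.partialDeriv i).memLp 2)
  have hsum := hasSum_sum (s := Finset.univ) fun i _ => hi i
  have hval : ∑ i, ∫ x, ‖partialDeriv i v x‖ ^ 2 = gradNormSq v := by
    rw [gradNormSq, ← integral_finsetSum _ (f := fun i x => ‖partialDeriv i v x‖ ^ 2) fun i _ =>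
      (((hv.partialDeriv i).continuous.norm.pow 2).integrable_unitAddTorus)]
  rw [hval] at hsum
  refine hsum.congr_fun fun k => ?_
  simp only [mFourierCoeff_complexify_partialDeriv hv, norm_smul]
  rw [freqNormSq, Finset.mul_sum, Finset.sum_mul]
  refine Finset.sum_congr rfl fun i _ => ?_
  have : ‖(2 * Real.pi * Complex.I * (k i : ℂ) : ℂ)‖ = 2 * Real.pi * |(k i : ℝ)| := by
    simp [abs_of_pos Real.pi_pos]
  rw [this, mul_pow, mul_pow, sq_abs]
  ring

/-- **Spectral `H²` seminorm**: for smooth real `v`,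
`∑ₖ (4π²|k|²)² ‖𝓕(complexify ∘ v)(k)‖² = ∫ ‖Δv‖²` as a `HasSum` (Parseval for `Δv` and
`𝓕(Δv)(k) = −4π²|k|² v̂(k)`, `Torus.mFourierCoeff_complexify_laplacian`). [cite: Grafakos2014, Prop. 3.2.7 (3)] -/
theorem hasSum_freqNormSq_sq_mul_norm_sq_mFourierCoeff (hv : IsSmooth v) :
    HasSum (fun k : d → ℤ => (4 * Real.pi ^ 2 * freqNormSq k) ^ 2 *
      ‖mFourierCoeff (EuclideanSpace.complexify ∘ v) k‖ ^ 2) (∫ x, ‖Torus.laplacian v x‖ ^ 2) := by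
  have h := hasSum_sq_norm_mFourierCoeff_complexify (hv.laplacian.memLp 2)
  refine h.congr_fun fun k => ?_
  rw [mFourierCoeff_complexify_laplacian hv, norm_neg, norm_smul, Complex.norm_real, Real.norm_eq_abs,
    abs_of_nonneg (by have := freqNormSq_nonneg k; positivity), mul_pow]
  ring

/-- The spectral moments of a smooth slice are summable with any bounded weight: if
`0 ≤ w k ≤ W` then `k ↦ w k |k|²ʲ ‖v̂(k)‖²` (`j = 1, 2`) is summable and its sum is at most
`W (4π²)⁻ʲ` times `‖∇v‖₂²`, resp. `∫ ‖Δv‖²`. Here the case `j = 2`. [folklore] -/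
theorem summable_weight_mul_freqNormSq_sq_mul (hv : IsSmooth v) {w : (d → ℤ) → ℝ} {W : ℝ}
    (hw0 : ∀ k, 0 ≤ w k) (hwW : ∀ k, w k ≤ W) :
    (Summable fun k : d → ℤ => w k * (freqNormSq k ^ 2 * ‖mFourierCoeff (EuclideanSpace.complexify ∘ v) k‖ ^ 2)) ∧
      ∑' k : d → ℤ, w k * (freqNormSq k ^ 2 * ‖mFourierCoeff (EuclideanSpace.complexify ∘ v) k‖ ^ 2) ≤
        W * ((4 * Real.pi ^ 2) ^ 2)⁻¹ * ∫ x, ‖Torus.laplacian v x‖ ^ 2 := by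
  have h := hasSum_freqNormSq_sq_mul_norm_sq_mFourierCoeff hv
  have hc : (0 : ℝ) < (4 * Real.pi ^ 2) ^ 2 := by positivity
  have h' : HasSum (fun k : d → ℤ => W * ((4 * Real.pi ^ 2) ^ 2)⁻¹ * ((4 * Real.pi ^ 2 * freqNormSq k) ^ 2 *
      ‖mFourierCoeff (EuclideanSpace.complexify ∘ v) k‖ ^ 2)) (W * ((4 * Real.pi ^ 2) ^ 2)⁻¹ *
      ∫ x, ‖Torus.laplacian v x‖ ^ 2) := h.mul_left _
  have hle : ∀ k, w k * (freqNormSq k ^ 2 * ‖mFourierCoeff (EuclideanSpace.complexify ∘ v) k‖ ^ 2) ≤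
      W * ((4 * Real.pi ^ 2) ^ 2)⁻¹ * ((4 * Real.pi ^ 2 * freqNormSq k) ^ 2 *
        ‖mFourierCoeff (EuclideanSpace.complexify ∘ v) k‖ ^ 2) := fun k => by
    rw [show W * ((4 * Real.pi ^ 2) ^ 2)⁻¹ * ((4 * Real.pi ^ 2 * freqNormSq k) ^ 2 *
        ‖mFourierCoeff (EuclideanSpace.complexify ∘ v) k‖ ^ 2) =
        W * (freqNormSq k ^ 2 * ‖mFourierCoeff (EuclideanSpace.complexify ∘ v) k‖ ^ 2) by
      field_simp]
    exact mul_le_mul_of_nonneg_right (hwW k) (by positivity)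
  have hs : Summable fun k : d → ℤ => w k * (freqNormSq k ^ 2 * ‖mFourierCoeff (EuclideanSpace.complexify ∘ v) k‖ ^ 2) :=
    h'.summable.of_nonneg_of_le (fun k => mul_nonneg (hw0 k) (by positivity)) hle
  exact ⟨hs, (hs.tsum_le_tsum hle h'.summable).trans_eq h'.tsum_eq⟩

/-- The case `j = 1`: `∑ₖ w k |k|² ‖v̂(k)‖² ≤ W (4π²)⁻¹ ‖∇v‖₂²` for `0 ≤ w ≤ W`. [folklore] -/
theorem summable_weight_mul_freqNormSq_mul (hv : IsSmooth v) {w : (d → ℤ) → ℝ} {W : ℝ}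
    (hw0 : ∀ k, 0 ≤ w k) (hwW : ∀ k, w k ≤ W) :
    (Summable fun k : d → ℤ => w k * (freqNormSq k * ‖mFourierCoeff (EuclideanSpace.complexify ∘ v) k‖ ^ 2)) ∧
      ∑' k : d → ℤ, w k * (freqNormSq k * ‖mFourierCoeff (EuclideanSpace.complexify ∘ v) k‖ ^ 2) ≤
        W * (4 * Real.pi ^ 2)⁻¹ * gradNormSq v := by
  have h := hasSum_freqNormSq_mul_norm_sq_mFourierCoeff hv
  have hc : (0 : ℝ) < 4 * Real.pi ^ 2 := by positivity
  have h' : HasSum (fun k : d → ℤ => W * (4 * Real.pi ^ 2)⁻¹ * (4 * Real.pi ^ 2 * freqNormSq k *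
      ‖mFourierCoeff (EuclideanSpace.complexify ∘ v) k‖ ^ 2)) (W * (4 * Real.pi ^ 2)⁻¹ * gradNormSq v) :=
    h.mul_left _
  have hle : ∀ k, w k * (freqNormSq k * ‖mFourierCoeff (EuclideanSpace.complexify ∘ v) k‖ ^ 2) ≤
      W * (4 * Real.pi ^ 2)⁻¹ * (4 * Real.pi ^ 2 * freqNormSq k *
        ‖mFourierCoeff (EuclideanSpace.complexify ∘ v) k‖ ^ 2) := fun k => by
    rw [show W * (4 * Real.pi ^ 2)⁻¹ * (4 * Real.pi ^ 2 * freqNormSq k *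
        ‖mFourierCoeff (EuclideanSpace.complexify ∘ v) k‖ ^ 2) =
        W * (freqNormSq k * ‖mFourierCoeff (EuclideanSpace.complexify ∘ v) k‖ ^ 2) by
      field_simp]
    exact mul_le_mul_of_nonneg_right (hwW k) (mul_nonneg (freqNormSq_nonneg k) (sq_nonneg _))
  have hs : Summable fun k : d → ℤ => w k * (freqNormSq k * ‖mFourierCoeff (EuclideanSpace.complexify ∘ v) k‖ ^ 2) :=
    h'.summable.of_nonneg_of_le (fun k => mul_nonneg (hw0 k)
      (mul_nonneg (freqNormSq_nonneg k) (sq_nonneg _))) hle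
  exact ⟨hs, (hs.tsum_le_tsum hle h'.summable).trans_eq h'.tsum_eq⟩

/-- First weighted moments are dominated by second ones: `∑ w|k|²‖v̂‖² ≤ ∑ w|k|⁴‖v̂‖²` for a
bounded weight `0 ≤ w ≤ W` and smooth `v`. [folklore] -/
theorem tsum_freqNormSq_mul_le_tsum_freqNormSq_sq_mul (hv : IsSmooth v) {w : (d → ℤ) → ℝ} {W : ℝ}
    (hw0 : ∀ k, 0 ≤ w k) (hwW : ∀ k, w k ≤ W) :
    ∑' k : d → ℤ, w k * (freqNormSq k * ‖mFourierCoeff (EuclideanSpace.complexify ∘ v) k‖ ^ 2) ≤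
      ∑' k : d → ℤ, w k * (freqNormSq k ^ 2 * ‖mFourierCoeff (EuclideanSpace.complexify ∘ v) k‖ ^ 2) :=
  (summable_weight_mul_freqNormSq_mul hv hw0 hwW).1.tsum_le_tsum
    (fun k => mul_le_mul_of_nonneg_left (mul_le_mul_of_nonneg_right (freqNormSq_le_freqNormSq_sq k)
      (sq_nonneg _)) (hw0 k)) (summable_weight_mul_freqNormSq_sq_mul hv hw0 hwW).1

end Parseval

/-! ### Comparison of moments, partial sums over balls, uniform bounds on a window -/

section Window

/-- Partial sums over the frequency balls converge to the series. [folklore] -/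
theorem tendsto_sum_freqBall {a : (d → ℤ) → ℝ} (ha : Summable a) :
    Tendsto (fun R : ℕ => ∑ k ∈ freqBall R, a k) atTop (𝓝 (∑' k, a k)) :=
  ha.hasSum.comp tendsto_freqBall_atTop

/-- Partial sums of a nonnegative summable family over the frequency balls are bounded by the
series. [folklore] -/
theorem sum_freqBall_le_tsum {a : (d → ℤ) → ℝ} (ha0 : ∀ k, 0 ≤ a k) (ha : Summable a) (R : ℕ) :
    ∑ k ∈ freqBall R, a k ≤ ∑' k, a k :=
  ha.sum_le_tsum _ fun k _ => ha0 k

omit [DecidableEq d] in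
/-- **Uniform `H²` bound on a compact time window**: for a field jointly smooth on `[a, b] × T^d`,
`a < b`, there is `D ≥ 0` with `∫ ‖Δu(t)‖² ≤ D` for all `t ∈ [a, b]` (the Laplacian is jointly
smooth, hence bounded on the compact window, and the torus has unit volume). [folklore] -/
theorem _root_.Literature.Analysis.FunctionSpaces.Torus.IsSmoothSpaceTimeOn.exists_forall_integral_norm_laplacian_sq_le
    [DecidableEq d] {a b : ℝ} {u : ℝ → UnitAddTorus d → EuclideanSpace ℝ d}
    (hu : IsSmoothSpaceTimeOn (Icc a b) u) (hab : a < b) :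
    ∃ D : ℝ, 0 ≤ D ∧ ∀ t ∈ Icc a b, ∫ x, ‖Torus.laplacian (u t) x‖ ^ 2 ≤ D := by
  have hL := hu.laplacian (uniqueDiffOn_Icc hab)
  obtain ⟨C, hC⟩ := hL.exists_norm_le_of_isCompact isCompact_Icc subset_rfl
  refine ⟨C ^ 2, sq_nonneg C, fun t ht => ?_⟩
  have hCt : ∀ x, ‖Torus.laplacian (u t) x‖ ≤ C := hC t ht
  have hC0 : 0 ≤ C := (norm_nonneg _).trans (hCt 0)
  have hint : Integrable (fun x => ‖Torus.laplacian (u t) x‖ ^ 2) volume :=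
    (((hu.isSmooth_slice ht).laplacian).continuous.norm.pow 2).integrable_unitAddTorus
  calc ∫ x, ‖Torus.laplacian (u t) x‖ ^ 2 ≤ ∫ _ : UnitAddTorus d, C ^ 2 :=
        integral_mono hint (integrable_const _) fun x =>
          pow_le_pow_left₀ (norm_nonneg _) (hCt x) 2
    _ = C ^ 2 := by simp

end Window

/-! ### Truncated Gevrey sums of a jointly smooth field: continuity and time derivative -/

section TimeDependence

variable {t₀ t₁ : ℝ} {u : ℝ → UnitAddTorus d → EuclideanSpace ℝ d}

omit [DecidableEq d] in
/-- The truncated Gevrey weight `s ↦ exp ((s − t₀) min(|k|, N))` has derivative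
`min(|k|, N) · exp ((s − t₀) min(|k|, N))`, and its square has derivative
`2 min(|k|,N) exp(…)²`. [folklore] -/
theorem hasDerivAt_exp_mul_min_sq (t₀ : ℝ) (N : ℝ) (k : d → ℤ) (t : ℝ) :
    HasDerivAt (fun s => Real.exp ((s - t₀) * min (Real.sqrt (freqNormSq k)) N) ^ 2)
      (2 * min (Real.sqrt (freqNormSq k)) N *
        Real.exp ((t - t₀) * min (Real.sqrt (freqNormSq k)) N) ^ 2) t := by
  have h1 : HasDerivAt (fun s => (s - t₀) * min (Real.sqrt (freqNormSq k)) N)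
      (1 * min (Real.sqrt (freqNormSq k)) N) t := (hasDerivAt_id t |>.sub_const t₀).mul_const _
  have h2 := (h1.exp).pow 2
  refine h2.congr_deriv ?_
  simp only [Nat.cast_ofNat, one_mul]
  ring

omit [DecidableEq d] in
/-- Finite weighted spectral sums `s ↦ ∑_{k ∈ K} exp((s−t₀)min(|k|,N))² c(k) ‖û(s,k)‖²` of a jointly
smooth field are continuous on the window. [folklore] -/
theorem continuousOn_sum_exp_sq_mul (hu : IsSmoothSpaceTimeOn (Icc t₀ t₁) u) (ht : t₀ < t₁) (N : ℝ)
    (K : Finset (d → ℤ)) (c : (d → ℤ) → ℝ) :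
    ContinuousOn (fun s => ∑ k ∈ K, Real.exp ((s - t₀) * min (Real.sqrt (freqNormSq k)) N) ^ 2 *
      (c k * ‖mFourierCoeff (EuclideanSpace.complexify ∘ u s) k‖ ^ 2)) (Icc t₀ t₁) := by
  refine continuousOn_finsetSum K fun k _ => ?_
  refine (Continuous.continuousOn (by fun_prop)).mul (continuousOn_const.mul ?_)
  exact continuousOn_norm_sq_mFourierCoeff hu (convex_Icc t₀ t₁) (uniqueDiffOn_Icc ht) k

/-- **Time derivative of the truncated Gevrey enstrophy partial sums** of a jointly smooth field on
`[t₀, t₁] × T^d`: with `e_k(s) = exp((s − t₀) min(|k|, N))`,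
`d/ds ∑_{k ∈ ball R} e_k(s)² |k|² ‖û(s,k)‖² = ∑_{k ∈ ball R} (2 min(|k|,N) e_k² |k|² ‖û‖² + e_k² |k|² · 2 Re ⟪𝓕(∂ₜu)(k), û(k)⟫)`
within `[t₀, t₁]` (product rule termwise, `hasDerivWithinAt_norm_sq_mFourierCoeff`). This is the
finite-dimensional, rigorous form of the time derivative of the Gevrey norm in Foias–Temam 1989,
§2. [cite: FoiasTemam1989, §2 (2.7)] -/
theorem hasDerivWithinAt_sum_exp_sq_mul_freqNormSq_mul (hu : IsSmoothSpaceTimeOn (Icc t₀ t₁) u)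
    (ht₀₁ : t₀ < t₁) (N : ℝ) (R : ℕ) {t : ℝ} (ht : t ∈ Icc t₀ t₁) :
    HasDerivWithinAt (fun s => ∑ k ∈ freqBall R, Real.exp ((s - t₀) * min (Real.sqrt (freqNormSq k)) N) ^ 2 *
        (freqNormSq k * ‖mFourierCoeff (EuclideanSpace.complexify ∘ u s) k‖ ^ 2))
      (∑ k ∈ freqBall R, (2 * min (Real.sqrt (freqNormSq k)) N *
          Real.exp ((t - t₀) * min (Real.sqrt (freqNormSq k)) N) ^ 2 *
            (freqNormSq k * ‖mFourierCoeff (EuclideanSpace.complexify ∘ u t) k‖ ^ 2) +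
        Real.exp ((t - t₀) * min (Real.sqrt (freqNormSq k)) N) ^ 2 * (freqNormSq k *
          (2 * (inner ℂ (mFourierCoeff (EuclideanSpace.complexify ∘ timeDerivWithin (Icc t₀ t₁) u t) k)
            (mFourierCoeff (EuclideanSpace.complexify ∘ u t) k)).re))))
      (Icc t₀ t₁) t := by
  refine HasDerivWithinAt.fun_sum fun k _ => ?_
  have h1 := (hasDerivAt_exp_mul_min_sq t₀ N k t).hasDerivWithinAt (s := Icc t₀ t₁)
  have h2 := (hasDerivWithinAt_norm_sq_mFourierCoeff hu (convex_Icc t₀ t₁) (uniqueDiffOn_Icc ht₀₁) ht k).const_mul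
    (freqNormSq k)
  exact h1.mul h2

end TimeDependence

end NSGevrey

end Literature.Analysis.FluidPDE
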